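import Summits.BirchSwinnertonDyer.BirchSwinnertonDyer.Theorems.PrintCf2RubinValueTwoSeamColemanDictionaryLevel
import Literature.NumberTheory.EllipticCurves.PAdicOneVariableSeriesFamilyOfColemanCoordModule
import HarnessLib

/-!
# Brick (c) at `p = 2`, the SEAM at one `𝔓` and one unramified level, IN THE MEASURE LANE'S CURRENCY: the weight-`k`, level-`m` reading of the
# divided series `L` (trivial unramified character) as a sum of SOCKET MOMENTS `[S⁰] D^k (j(Φ r) ∘ ϑ)` of the one-`𝔓` package (g13's junction (J-i))

Cell `bsd-print-cf2`, width seat `bsd-line-cf2c-w7` g31, route C `PrintCf2RubinValueTwo`, crux of record stmt-BirchSwinnertonDyer-24033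
`TwoVariableMainConjAtSplitTwoQuad` (23720 nominal), BRICK §4(c), memo v13 (M2)(i); `--supports` the crux as a helper.  THEOREMS ONLY (0 sorry,
no named fact, no definition); Theses-free; β-agnostic.  BSD is not proved by any of this.

`…SeamColemanDictionaryLevel` (T10₀-core) reads the (c)-capstone's relation `φ_ε(Σ_j Col β (j)) = (t_v·C g − C n)·L` at `(X, T) = (0, γ^{k+1} − 1)`:
`Σ_σ σ(mom_k(r_{β,m})) = (Tr θ_m)·((v^{k+1} − n)·L(0; a_k)·mom_k(1))`.  The measure lane (`…EllipticUnitsLocalMeasure`, p728641) reads moments as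
`[S⁰] mahlerD^[k]` of the `Θ`-read log-free series in the `𝔾_m`-coordinate `ϑ = compSeriesC`; g13's junction
(`PAdicOneVariableSeriesFamilyOfColemanCoordModule.constantCoeff_mahlerD_iterate_subst_compSeriesC_coordToKer`) says
`[S⁰] D^k (j(Φ r) ∘ ϑ) = ε_ϑ^k · j(mom_k r)` for EVERY `r` of the coordinate module, in the absolute Lubin–Tate frame `π = u·2`.  THIS file composes
the two at `π := u·2` (T10₀-core is universal in `π`, so no transport is needed):

* ★★★ `sum_constantCoeff_mahlerD_iterate_eq_of_colemanDeltaCoinvFun_indexTraceₗ_eq` — under T10₀-core's hypothesis, for every level `m` and weight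
  `k ≡ parity(ε)`: **`Σ_{σ ∈ Gal(E_m/F)} [S⁰] D^k (j(Φ(r_{β,m}^σ)) ∘ ϑ) = ε_ϑ^k · j((Σ_σ σθ_m)·((v^{k+1} − n)·tEval_{a_k}(κ_m L)·mom_k(1)))`**, where
  `r_{β,m}^σ` is the `σ`-conjugate of the level-`m` Coleman coordinate (`coordMoment_map_unitBallEquiv`) and `j(Φ(r_{β,m})) = j((δ_E g_{β_m})~)` is the
  measure lane's series of `β_m` VERBATIM (`map_coordToKer_relUnitCoordTwo`).  Applying the reading `Θ` (a ring map) to both sides gives the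
  `ℂ₂`-valued form consumed by `integral_character_pow_succ_of_twisting_eq_induce_seriesFamily`.

HONEST LABEL (pen rail (i)): trivial-character component of the level-`m` identity; NOT the level-`m` identity ((M2)(i)′ of memo v13: the non-trivial
characters of `Gal(E_m/F)` need the `X ↦ ζ − 1` base change, not in the tree).

## References
* [deShalit1987] E. de Shalit, *Iwasawa theory of elliptic curves with complex multiplication* (1987), I §3.4 Lemma (ii), §3.5 (11), §3.7, §3.8 (16)–(17);
  II §4.6 (14), §4.7 (16)–(17), §4.12 (29)–(31); III §1.3.
-/

noncomputable section

set_option linter.dupNamespace false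
set_option autoImplicit false

open scoped PowerSeries.WithPiTopology

namespace Summit.BirchSwinnertonDyer.BirchSwinnertonDyer.Theorems.PrintCf2.SeamColemanDictionaryLevelMeasure

open ValuativeRel IsLocalRing Field Finset MvPowerSeries
open Literature.NumberTheory.GaloisRepresentations Literature.NumberTheory.GaloisRepresentations.IsNonarchimedeanLocalField
  Literature.NumberTheory.GaloisRepresentations.LubinTate Literature.NumberTheory.PAdicHodge
open Literature.NumberTheory.EllipticCurves
open Summit.BirchSwinnertonDyer.BirchSwinnertonDyer.Theorems.PrintCf2.SeamColemanDictionaryLevel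

variable {F : Type} [Field F] [ValuativeRel F] [TopologicalSpace F] [IsNonarchimedeanLocalField F]

attribute [local instance] ltNormUniformSpace ltNormIsUniformAddGroup rk1 nF nE fintypeResidueField

variable {p : ℕ} [hp : Fact p.Prime] {d : ℕ} [NeZero d] (hd : d.Coprime p)
-- the absolute Lubin–Tate frame `π = u·2` of the measure lane
variable (h2 : (valuation F).IsUniformizer (((2 : ℕ) : 𝒪[F]) : F)) (u₀ : 𝒪[F]ˣ)
variable (E : ℕ → IntermediateField F (AlgebraicClosure F)) [∀ m, FiniteDimensional F (E m)] [∀ m, Normal F (E m)]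
  [∀ m, IsGalois F (E m)] (hmono : Monotone E) (hE : ∀ m, E m ≤ maxUnramified F) (hdeg : ∀ m, Module.finrank F (E m) = d * p ^ m)
  {σ₀ : absoluteGaloisGroup F} (hσ₀ : IsAbsArithFrob σ₀) (hq : residueFieldCard F = 2)
variable (u : (LTCoeff F)ˣ) (hu : LTCoeff.of F ((u₀ : 𝒪[F]) * ((2 : ℕ) : 𝒪[F])) = residueFieldCard F * u) (γ : 𝒪[F]ˣ)
variable [IsAdicComplete (Ideal.span {intBase F (LTCoeff.of F ((u₀ : 𝒪[F]) * ((2 : ℕ) : 𝒪[F])))}) (PowerSeries 𝒪[F])]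
variable (w : 𝒪[F]ˣ) (hγ : (γ : 𝒪[F]) = 1 + ((u₀ : 𝒪[F]) * ((2 : ℕ) : 𝒪[F])) ^ 2 * w) (ε : PowerSeries (PowerSeries 𝒪[F]))
variable [IsAdicComplete (Ideal.span {(p : 𝒪[F])}) 𝒪[F]]
variable {θ : ∀ m, unitBall (E m)} (hθ : ∀ m, IsIntegralNormalGen (E m) (θ m))
  (hcoh : ∀ m, unitBallTrace (hmono (Nat.le_succ m)) (θ (m + 1)) = θ m)
-- the `𝔾_m`-comparison unit `εϑ` (`σ₀ εϑ = u₀·εϑ`) and the coefficient embedding `j : 𝒪_{E_m} → 𝐃` at the level `m`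
variable {εϑ : (maxUnramifiedCompletion F)ˣ}
  (hεϑ : maxUnramifiedCompletion.galAut F σ₀ (εϑ : maxUnramifiedCompletion F) =
    algebraMap 𝒪[F] (maxUnramifiedCompletion F) (u₀ : 𝒪[F]) * (εϑ : maxUnramifiedCompletion F))

set_option maxHeartbeats 800000 in
include hdeg hE hσ₀ hu in
/-- ★★★ **T10₀ IN THE MEASURE LANE'S CURRENCY** (`π = u₀·2`, one prime, level `m`, weight `k ≡ parity(ε)`): under the (c)-capstone's relation
`φ_ε(Σ_j Col β (j)) = (t_v·C g − C n)·L` (`g(0) = 1`),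
**`Σ_{σ ∈ Gal(E_m/F)} [S⁰] mahlerD^[k] ((j(Φ(r_{β,m}^σ))) ∘ ϑ) = ε_ϑ^k · j((Σ_σ σθ_m)·((v^{k+1} − n)·tEval_{a_k}(κ_m L)·mom_k(1)))`**, `ε_ϑ = [S]ϑ`,
`ϑ = compSeriesC h2 hσ₀ u₀ hεϑ`, `Φ = coordToKer` — the left side is the sum over the conjugates of the SOCKET MOMENTS of the measure lane's series of
`β_m` (`j(Φ(r_{β,m})) = j((δ_E g_{β_m})~)`, `map_coordToKer_relUnitCoordTwo`).  Trivial-character component of the level-`m` identity; NOT the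
level-`m` identity. [cite: deShalit1987, I §3.4 Lemma (ii), §3.5 (11), §3.8 (16)–(17); II §4.7 (16)–(17), §4.12 (29)–(31)] -/
theorem sum_constantCoeff_mahlerD_iterate_eq_of_colemanDeltaCoinvFun_indexTraceₗ_eq
    {β : ∀ m, RelNormCoherentUnits (isUniformizer_unit_mul h2 u₀) (E m)}
    (hβ : ∀ m, (β (m + 1)).baseNorm (isUniformizer_unit_mul h2 u₀) (hmono (Nat.le_succ m)) = β m)
    (v : 𝒪[F]ˣ) (g : PowerSeries 𝒪[F]) (hg : PowerSeries.constantCoeff g = 1) (n : ℕ) (L : PowerSeries (PowerSeries 𝒪[F]))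
    (hL : colemanDeltaCoinvFun (isUniformizer_unit_mul h2 u₀) hq (intBase F) u hu γ (eq_zero_of_C_pi_mul_eq_zero_integer (isUniformizer_unit_mul h2 u₀)) w hγ ε
        (indexTraceₗ (isUniformizer_unit_mul h2 u₀) hq u hu γ (colemanImage hd (isUniformizer_unit_mul h2 u₀) E hmono hE hdeg hσ₀ hq u hu γ hθ hcoh hβ)) =
      (colemanDeltaCoinvFun (isUniformizer_unit_mul h2 u₀) hq (intBase F) u hu γ (eq_zero_of_C_pi_mul_eq_zero_integer (isUniformizer_unit_mul h2 u₀)) w hγ ε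
          (unitTwistₗ (isUniformizer_unit_mul h2 u₀) hq (intBase F) u hu γ v (TActModule.ofPS _ _ 1)) * PowerSeries.C g -
        PowerSeries.C ((n : ℕ) : PowerSeries 𝒪[F])) * L)
    (m k : ℕ) [IsAdicComplete (Ideal.span {algebraMap (LTCoeff F) (unitBall (E m)) (LTCoeff.of F ((u₀ : 𝒪[F]) * ((2 : ℕ) : 𝒪[F])))}) (unitBall (E m))]
    (hεk : PowerSeries.map ((algebraMap 𝒪[F] (unitBall (E m))).comp (PowerSeries.constantCoeff (R := 𝒪[F]))) ε = (-1) ^ (k + 1))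
    (j : unitBall (E m) →+* UnrCoeff F)
    (hj : j.comp (algebraMap (LTCoeff F) (unitBall (E m))) = (intToUnrCoeff F).comp (LTCoeff.of F).symm.toRingHom) :
    ∑ σ : E m ≃ₐ[F] E m, PowerSeries.constantCoeff (mahlerD^[k]
        (((coordToKer (isUniformizer_unit_mul h2 u₀) (E m) u
          (PowerSeries.map (unitBallEquiv (E m) σ : unitBall (E m) →+* unitBall (E m))
            (relUnitCoordTwo (isUniformizer_unit_mul h2 u₀) (E m) hq (hE m) hσ₀ u hu (β m)))).map j).subst (compSeriesC h2 hσ₀ u₀ hεϑ))) =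
      PowerSeries.coeff 1 (compSeriesC h2 hσ₀ u₀ hεϑ) ^ k *
        j ((∑ σ : E m ≃ₐ[F] E m, unitBallEquiv (E m) σ (θ m)) *
          ((algebraMap 𝒪[F] (unitBall (E m)) (v : 𝒪[F]) ^ (k + 1) - (n : unitBall (E m))) *
            tEval (algebraMap_unit_pow_sub_one_mem (isUniformizer_unit_mul h2 u₀) (E m) hq γ k)
              (PowerSeries.map ((algebraMap 𝒪[F] (unitBall (E m))).comp (PowerSeries.constantCoeff (R := 𝒪[F]))) L) *
            coordMoment (isUniformizer_unit_mul h2 u₀) (E m) u k 1)) := by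
  rw [← sum_coordMoment_relUnitCoordTwo_eq_of_colemanDeltaCoinvFun_indexTraceₗ_eq hd (isUniformizer_unit_mul h2 u₀) E hmono hE hdeg hσ₀ hq u hu γ
    w hγ ε hθ hcoh hβ v g hg n L hL m k hεk, map_sum, Finset.mul_sum]
  refine Finset.sum_congr rfl fun σ _ ↦ ?_
  rw [constantCoeff_mahlerD_iterate_subst_compSeriesC_coordToKer h2 u₀ (E m) hq u j hj hσ₀ hεϑ,
    coordMoment_map_unitBallEquiv (isUniformizer_unit_mul h2 u₀) u σ k]

end Summit.BirchSwinnertonDyer.BirchSwinnertonDyer.Theorems.PrintCf2.SeamColemanDictionaryLevelMeasure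

end
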